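import Literature.Computability.AlgebraicComplexity.MS21ReadOnceHittingSetProofs
import HarnessLib

/-!
# Medini–Shpilka 2021, §5.2 engine of Lemma 5.15 (lem:pitDerivRoanf): independent maps hit affine
# images of products of read-once polynomials, also behind coordinate derivatives and restrictions

Theorem-only support file for `MS21DenseOrbitsHittingSets.lean` (cell `val-lit`, seat t18 g5; brick
"F5" for the `MS2021_thm_35` consortium of seat x5 g3). It PROVES the two generic steps of the printed
proof of Lemma 5.15 [MediniShpilka2021, arXiv:2102.05632 p0030:L1–L26]:

* "As `(∂⁴f/∂w∂u∂v_k∂v_ℓ)|_{ℓ_r = ℓ_m = 0}` is a non-zero product of ROPs composed with an affine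
  transformation, where the underlying ROPs depend on at most `4^Δ` variables, we get from
  (thm:PITROPINV) that `… ∘ G_{2Δ+1} ≠ 0`": **a nonzero constant times a product of read-once
  polynomials on `≤ 2^t` leaves each, composed with an invertible affine map, is hit by every
  `B`-independent map with `B ≥ t + 1`** (`MS2021.bind₁_affSubst_C_mul_prod_ne_zero_of_isROP`) — from
  the tree's strong form of Thm 33 (`MS2021.bind₁_ne_zero_of_isROP_of_mem_affOrbit`,
  `MS21ReadOnceHittingSetProofs.lean`), factor by factor in a domain;
* "(lem:indProjectZero) implies that `∂⁴f/…(G_{2Δ+1} + G_2) ≠ 0`. Finally, from (lem:indDerivLinear) it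
  follows that `∂²f/∂w∂u ∘ (G_{2Δ+1} + G_2 + G_1) ≠ 0`": **the derivatives-then-kills reduction** — if,
  for an upstairs polynomial `P`, some `a` coordinate partial derivatives followed by setting a set
  `Z` of coordinates to `0` yield a polynomial whose affine images are hit by every `B₀`-independent
  map, then the affine images `P(Ax + b)` (`A` invertible) are hit by every `B`-independent map with
  `B ≥ B₀ + a + |Z|` (`MS2021.hit_affSubst_of_hit_pderivs`, `MS2021.hit_affSubst_of_hit_kill`, combined
  in `MS2021.bind₁_affSubst_ne_zero_of_kill_pderivs_eq_prod`): one block per derivative via Lemma 3.8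
  (dual direction, toolkit `sum_C_mul_pderiv_affSubst`) and Lemma 3.9 (toolkit
  `bind₁_peel_ne_zero_of_dirDeriv`), one block per killed coordinate via Lemma 3.10 (toolkit
  `exists_shift_affSubst_eq` + `bind₁_peel_ne_zero_of_shift`) — the §3 toolkit is
  `MS21IndependentMapLemmas.lean`, seat t24 g5.

With these, Lemma 5.15 for `ANF_Δ` (`4^Δ = 2^{2Δ}` leaves, `a = |Z| = 2`, hence `2Δ + 5`) reduces to
the combinatorial Lemma 5.14 (hitSecondDeriv) about the canonical ROANF, which is not treated here.

No new definitions, no new facts (D-0026): net debt `0` (support file). HONEST FRAMING: these are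
steps of a known 2021 proof; `VP ≠ VNP` is NOT proved and this is no progress on it.

## References
* [MediniShpilka2021] D. Medini, A. Shpilka, CCC 2021 (LIPIcs 200:19) §5.2: Lemma 5.15
  (lem:pitDerivRoanf) and its proof (arXiv:2102.05632 held text p0030:L1–L26); Thm 33; §3 Lemmas
  3.8–3.10.
-/

noncomputable section

open MvPolynomial Matrix

namespace Literature.Computability.AlgebraicComplexity

namespace MS2021

/-! ### Products of read-once polynomials in an affine orbit -/

section Products

variable {K : Type*} [Field K] {m n : ℕ}

/-- `f ↦ f(Ax + b)` is injective for invertible `A` (the inverse substitution `(A⁻¹, -A⁻¹b)`).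
[cite: MediniShpilka2021, §1.1.6 (CCC p.19:9); §6 proof of Thm 42 ("as we compose with invertible affine maps"; arXiv p0034:L8)] -/
theorem affSubst_ne_zero (h : m ≤ n) {A : Matrix (Fin n) (Fin n) K} (hA : IsUnit A.det)
    (b : Fin n → K) {g : MvPolynomial (Fin m) K} (hg : g ≠ 0) : affSubst h A b g ≠ 0 := by
  intro h0
  apply hg
  rw [affSubst_eq_aeval_rename] at h0
  have h1 := congr_arg (aeval (fun i : Fin n => (∑ j, C (A⁻¹ i j) * X j) + C ((-(A⁻¹ *ᵥ b)) i))) h0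
  rw [aeval_affine_inv_apply hA, map_zero] at h1
  exact rename_injective _ (Fin.castLE_injective h) (by rw [h1, map_zero])

/-- `f ↦ f(Ax + b)` is multiplicative on finite products. [cite: MediniShpilka2021, §1.1.6 eq. (2) (CCC p.19:9)] -/
theorem affSubst_prod {ι : Type*} (h : m ≤ n) (A : Matrix (Fin n) (Fin n) K) (b : Fin n → K)
    (L : Finset ι) (Q : ι → MvPolynomial (Fin m) K) :
    affSubst h A b (∏ l ∈ L, Q l) = ∏ l ∈ L, affSubst h A b (Q l) := by
  unfold affSubst
  rw [map_prod]

/-- **"A non-zero product of ROPs composed with an affine transformation, where the underlying ROPs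
depend on at most `2^t` variables", is hit by every `(t+1)`-independent map** (and by every
`B`-independent map with `B ≥ t + 1`) — the use of Thm 33 (thm:PITROPINV) in the proof of Lemma 5.15,
here from the tree's strong form of Thm 33 for every leaf count, factor by factor.
[cite: MediniShpilka2021, proof of Lemma 5.15 (arXiv p0030:L22-L24); Thm 33] -/
theorem bind₁_affSubst_C_mul_prod_ne_zero_of_isROP {ι : Type*} {t : ℕ} (L : Finset ι)
    (Q : ι → MvPolynomial (Fin m) K) (S : ι → Finset (Fin m))
    (hQ : ∀ l ∈ L, IsROP (S l) (Q l)) (hS : ∀ l ∈ L, (S l).card ≤ 2 ^ t) (c₀ : K)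
    (hne : C c₀ * ∏ l ∈ L, Q l ≠ 0)
    (h : m ≤ n) {A : Matrix (Fin n) (Fin n) K} (hA : IsUnit A.det) (b : Fin n → K)
    {B c : ℕ} (G : Fin n → MvPolynomial (Fin B × (Fin c ⊕ Unit)) K) (hG : IsIndependent B G)
    (hB : t + 1 ≤ B) :
    bind₁ G (affSubst h A b (C c₀ * ∏ l ∈ L, Q l)) ≠ 0 := by
  classical
  obtain ⟨t', rfl⟩ : ∃ t', B = t' + 1 := ⟨B - 1, by omega⟩
  have hc₀ : c₀ ≠ 0 := by
    rintro rfl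
    exact hne (by rw [C_0, zero_mul])
  have hQ0 : ∀ l ∈ L, Q l ≠ 0 := fun l hl h0 =>
    hne (by rw [Finset.prod_eq_zero hl h0, mul_zero])
  rw [affSubst_mul, affSubst_C, affSubst_prod, map_mul, bind₁_C_right, map_prod]
  refine mul_ne_zero (by rwa [Ne, C_eq_zero]) (Finset.prod_ne_zero_iff.mpr fun l hl => ?_)
  have hcard : (S l).card ≤ 2 ^ t' :=
    (hS l hl).trans (Nat.pow_le_pow_right (by norm_num) (by omega))
  exact bind₁_ne_zero_of_isROP_of_mem_affOrbit (hQ l hl) hcard ⟨h, A, b, hA, rfl⟩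
    (affSubst_ne_zero h hA b (hQ0 l hl)) hG

end Products

/-! ### The derivatives-then-kills reduction (Lemmas 3.8–3.10, one block per coordinate) -/

section Reduction

variable {K : Type*} [Field K] {m n : ℕ}

/-- **One block per coordinate derivative** (Lemma 3.8 + Lemma 3.9, iterated): if the affine images of
`∂_{w_1} ⋯ ∂_{w_a} P` (coordinate partial derivatives, `D = (w_1, …, w_a)`) are hit by every
`B₀`-independent map, then the affine images of `P` are hit by every `B`-independent map with
`B ≥ B₀ + a` ("from (lem:indDerivLinear) it follows that `∂²f/∂w∂u(G_{2Δ+1} + G_2 + G_1) ≠ 0`"; the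
`f`-level directional derivatives along the dual directions are these coordinate derivatives
upstairs, Lemma 3.8). [cite: MediniShpilka2021, proof of Lemma 5.15 (arXiv p0030:L17-L26); Lemmas 3.8, 3.9] -/
theorem hit_affSubst_of_hit_pderivs (h : m ≤ n) {a : ℕ} (D : Fin a → Fin m) :
    ∀ (B₀ : ℕ) (P : MvPolynomial (Fin m) K),
      (∀ (A : Matrix (Fin n) (Fin n) K) (b : Fin n → K), IsUnit A.det →
        ∀ (B c : ℕ) (H : Fin n → MvPolynomial (Fin B × (Fin c ⊕ Unit)) K), IsIndependent B H →
          B₀ ≤ B → bind₁ H (affSubst h A b ((List.ofFn D).foldr (fun w p => pderiv w p) P)) ≠ 0) →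
      ∀ (A : Matrix (Fin n) (Fin n) K) (b : Fin n → K), IsUnit A.det →
        ∀ (B c : ℕ) (G : Fin n → MvPolynomial (Fin B × (Fin c ⊕ Unit)) K), IsIndependent B G →
          B₀ + a ≤ B → bind₁ G (affSubst h A b P) ≠ 0 := by
  induction a with
  | zero =>
      intro B₀ P hP A b hA B c G hG hB
      have := hP A b hA B c G hG (by omega)
      rwa [List.ofFn_zero, List.foldr_nil] at this
  | succ a ih =>
      intro B₀ P hP A b hA B c G hG hB
      -- first the inner `a` derivatives (induction, with one more block in reserve) …
      refine ih (fun l => D l.succ) (B₀ + 1) P ?_ A b hA B c G hG (by omega)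
      intro A' b' hA' B' c' H hH hB'
      -- … then the outermost derivative `∂_{w_1}`: peel one block, Lemma 3.8, Lemma 3.9
      obtain ⟨B'', rfl⟩ : ∃ B'', B' = B'' + 1 := ⟨B' - 1, by omega⟩
      obtain ⟨H₁, H', hH₁, hH', hHeq⟩ := isIndependent_succ_iff.mp hH
      have hinner := hP A' b' hA' B'' c' H' hH' (by omega)
      rw [List.ofFn_succ, List.foldr_cons, ← sum_C_mul_pderiv_affSubst h hA' b' _ (D 0)] at hinner
      have hHfun : H = fun j => rename (Prod.mk 0) (H₁ j) + rename (Prod.map Fin.succ id) (H' j) :=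
        funext hHeq
      rw [hHfun]
      exact bind₁_peel_ne_zero_of_dirDeriv hH₁ H' _ _ hinner

/-- One more killed coordinate: `σ_Z ∘ σ_{x_r} = σ_{Z ∪ {r}}` for the substitutions setting a set of
coordinates to `0`. [cite: MediniShpilka2021, Lemma 3.10 ("apply the result iteratively"; arXiv p0018:L19-L20)] -/
theorem aeval_kill_aeval_kill_single' (Z : Finset (Fin m)) (r : Fin m) (Q : MvPolynomial (Fin m) K) :
    aeval (fun w => if w ∈ Z then (0 : MvPolynomial (Fin m) K) else X w)
        (aeval (fun w => if w = r then (0 : MvPolynomial (Fin m) K) else X w) Q) =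
      aeval (fun w => if w ∈ insert r Z then (0 : MvPolynomial (Fin m) K) else X w) Q := by
  classical
  rw [← AlgHom.comp_apply, comp_aeval]
  have hfun : (fun w => aeval (fun w => if w ∈ Z then (0 : MvPolynomial (Fin m) K) else X w)
      (if w = r then (0 : MvPolynomial (Fin m) K) else X w)) =
      fun w => if w ∈ insert r Z then (0 : MvPolynomial (Fin m) K) else X w := by
    funext w
    by_cases hw : w = r
    · subst hw
      simp
    · rw [if_neg hw, aeval_X]
      have hiff : w ∈ insert r Z ↔ w ∈ Z := by
        rw [Finset.mem_insert]
        simp only [hw, false_or]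
      by_cases hwZ : w ∈ Z
      · rw [if_pos hwZ, if_pos (hiff.mpr hwZ)]
      · rw [if_neg hwZ, if_neg (fun h' => hwZ (hiff.mp h'))]
  rw [hfun]

/-- **One block per killed coordinate** (Lemma 3.10, iterated over `Z`): if the affine images of
`Q|_{x_w = 0, w ∈ Z}` are hit by every `B₀`-independent map, then the affine images of `Q` are hit by
every `B`-independent map with `B ≥ B₀ + |Z|` ("(lem:indProjectZero) implies that
`∂⁴f/…(G_{2Δ+1} + G_2) ≠ 0`"). [cite: MediniShpilka2021, proof of Lemma 5.15 (arXiv p0030:L24-L25); Lemma 3.10] -/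
theorem hit_affSubst_of_hit_kill (h : m ≤ n) (B₀ : ℕ) (Z : Finset (Fin m)) :
    ∀ (Q : MvPolynomial (Fin m) K),
      (∀ (A : Matrix (Fin n) (Fin n) K) (b : Fin n → K), IsUnit A.det →
        ∀ (B c : ℕ) (H : Fin n → MvPolynomial (Fin B × (Fin c ⊕ Unit)) K), IsIndependent B H →
          B₀ ≤ B → bind₁ H (affSubst h A b
            (aeval (fun w => if w ∈ Z then (0 : MvPolynomial (Fin m) K) else X w) Q)) ≠ 0) →
      ∀ (A : Matrix (Fin n) (Fin n) K) (b : Fin n → K), IsUnit A.det →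
        ∀ (B c : ℕ) (G : Fin n → MvPolynomial (Fin B × (Fin c ⊕ Unit)) K), IsIndependent B G →
          B₀ + Z.card ≤ B → bind₁ G (affSubst h A b Q) ≠ 0 := by
  classical
  induction Z using Finset.induction_on with
  | empty =>
      intro Q hQ A b hA B c G hG hB
      have hX : (fun w => if w ∈ (∅ : Finset (Fin m)) then (0 : MvPolynomial (Fin m) K) else X w) =
          X := funext fun w => if_neg (Finset.notMem_empty w)
      have := hQ A b hA B c G hG (by simpa using hB)
      rwa [hX, aeval_X_left, AlgHom.id_apply] at this
  | insert r Z hr ih =>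
      intro Q hQ A b hA B c G hG hB
      rw [Finset.card_insert_of_notMem hr] at hB
      obtain ⟨B', rfl⟩ : ∃ B', B = B' + 1 := ⟨B - 1, by omega⟩
      obtain ⟨G₁, G', hG₁, hG', hGeq⟩ := isIndependent_succ_iff.mp hG
      obtain ⟨i₀, L, A', b', -, hA', heq⟩ := exists_shift_affSubst_eq h hA b Q r
      have hQ₁ := ih (aeval (fun w => if w = r then (0 : MvPolynomial (Fin m) K) else X w) Q)
        (fun A'' b'' hA'' B'' c'' H hH hB'' => by
          rw [aeval_kill_aeval_kill_single']
          exact hQ A'' b'' hA'' B'' c'' H hH hB'') A' b' hA' B' c G' hG' (by omega)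
      rw [← heq] at hQ₁
      have hGfun : G = fun j => rename (Prod.mk 0) (G₁ j) + rename (Prod.map Fin.succ id) (G' j) :=
        funext hGeq
      rw [hGfun]
      exact bind₁_peel_ne_zero_of_shift hG₁ G' (affSubst h A b Q) i₀ L hQ₁

/-- **The engine of Lemma 5.15** (derivatives, then kills, then a product of read-once polynomials):
let `P ∈ K[y_1, …, y_m]`, coordinates `D = (w_1, …, w_a)` and `Z ⊆ [m]`; if
`(∂_{w_1} ⋯ ∂_{w_a} P)|_{y_w = 0, w ∈ Z} = c · ∏_l Q_l ≠ 0` with each `Q_l` read-once on `≤ 2^t` leaves,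
then `P(Ax + b) ∘ G ≠ 0` for every invertible affine `(A, b)` and every `B`-independent map `G` with
`B ≥ t + 1 + a + |Z|` (for `ANF_Δ`: `t = 2Δ`, `a = |Z| = 2`, `B = 2Δ + 5`).
[cite: MediniShpilka2021, Lemma 5.15 and its proof (arXiv p0030:L1-L26)] -/
theorem bind₁_affSubst_ne_zero_of_kill_pderivs_eq_prod {ι : Type*} {t a : ℕ}
    (P : MvPolynomial (Fin m) K) (D : Fin a → Fin m) (Z : Finset (Fin m))
    (L : Finset ι) (Q : ι → MvPolynomial (Fin m) K) (S : ι → Finset (Fin m)) (c₀ : K)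
    (hQ : ∀ l ∈ L, IsROP (S l) (Q l)) (hS : ∀ l ∈ L, (S l).card ≤ 2 ^ t)
    (hform : aeval (fun w => if w ∈ Z then (0 : MvPolynomial (Fin m) K) else X w)
      ((List.ofFn D).foldr (fun w p => pderiv w p) P) = C c₀ * ∏ l ∈ L, Q l)
    (hne : C c₀ * ∏ l ∈ L, Q l ≠ 0)
    (h : m ≤ n) {A : Matrix (Fin n) (Fin n) K} (hA : IsUnit A.det) (b : Fin n → K)
    {B c : ℕ} (G : Fin n → MvPolynomial (Fin B × (Fin c ⊕ Unit)) K) (hG : IsIndependent B G)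
    (hB : t + 1 + a + Z.card ≤ B) : bind₁ G (affSubst h A b P) ≠ 0 := by
  refine hit_affSubst_of_hit_pderivs h D (t + 1 + Z.card) P ?_ A b hA B c G hG (by omega)
  intro A' b' hA' B' c' H hH hB'
  refine hit_affSubst_of_hit_kill h (t + 1) Z _ ?_ A' b' hA' B' c' H hH (by omega)
  intro A'' b'' hA'' B'' c'' H' hH' hB''
  rw [hform]
  exact bind₁_affSubst_C_mul_prod_ne_zero_of_isROP L Q S hQ hS c₀ hne h hA'' b'' H' hH' hB''

end Reduction

end MS2021

end Literature.Computability.AlgebraicComplexity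

end
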